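import Literature.Probability.Percolation.KestenZhangNoArm
import Literature.Probability.Percolation.SeedLemma
import HarnessLib

/-!
# `stub_noArmSmallOfTheta` of line `birth` (crux `FiniteClusterVolumeTail`, stmt-CriticalPhenomena-0943):
# clause (a) of the Kesten–Zhang bad-block event is rare from density alone

Registered stub `stub_noArmSmallOfTheta` of the skeleton `Cruxes/FiniteClusterVolumeTail/Lines/birth.lean`
(route `PercDebrisSweep`, sub-problem `PercolationContinuityZ3`).

Statement: for every `p` with `θ(p) > 0` on `ℤ³` and every `ε > 0` there is `N₁` such that for all
`N₀ ≥ N₁`, `P_p(NoArm N₀) ≤ ε`, where `KestenZhang.NoArm N₀` (`KestenZhangBlocks.lean`) is the event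
that no vertex of the origin block `B(N₀)` is joined inside `B̃ = B(5N₀+2)` to the inner boundary of
`B̃`. This is Grimmett, *Percolation* (1999), proof of Thm (8.65), p. 223: "Since `θ(p) > 0`,
`P_p(B_x ↔ ∞) → 1` as `N → ∞`" — run at the SAME density, with no slab and no `p > p_c`.

Proof (all inputs in tree): `P_p`-almost every configuration is a lattice configuration
`ω ⊆ E(ℤ³)` (`ae_subset_edgeSet`); on such `ω`, `NoArm N₀` forces every vertex of `B(N₀)` to lie in
a finite open cluster (`KestenZhang.NoArm_inter_subset_noPercolation`: an infinite cluster at a vertex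
of `B(N₀)` leaves `B̃` through `∂B̃`), i.e. `ω ∉ GM.boxPerc 3 N₀`; and `P_p((boxPerc 3 N₀)ᶜ) → 0`
as `N₀ → ∞` whenever `θ(p) > 0` (`GM.tendsto_prob_not_boxPerc`, the zero–one law plus continuity of
measure from below). Hence `P_p(NoArm N₀) ≤ P_p((boxPerc 3 N₀)ᶜ) ≤ ε` for `N₀` large.
-/

noncomputable section

namespace Summit.CriticalPhenomena.PercolationContinuityZ3.Theorems.FiniteClusterVolumeTail

open MeasureTheory Filter Literature.Probability.Percolation Literature.Probability.LatticeModels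

/-- On lattice configurations `ω ⊆ E(ℤ³)`, the event `NoArm N₀` implies that no vertex of the box
`B(N₀)` lies in an infinite open cluster, i.e. `ω ∉ boxPerc 3 N₀`. -/
theorem not_mem_boxPerc_of_mem_NoArm {N₀ : ℕ} {ω : BondConfig (Site 3)}
    (hω : ω ⊆ (zdGraph 3).edgeSet) (hNo : ω ∈ KestenZhang.NoArm (d := 3) N₀) :
    ω ∈ (GM.boxPerc 3 N₀)ᶜ := by
  have hmem : ω ∈ GKZ.noPercolation (GM.ball (0 : Site 3) N₀) :=
    KestenZhang.NoArm_inter_subset_noPercolation N₀ ⟨hNo, hω⟩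
  rintro ⟨y, hy, hperc⟩
  refine hmem y ?_ hperc
  rw [GM.ball_zero]
  exact hy

/-- `P_p(NoArm N₀) ≤ P_p(B(N₀) ↮ ∞)`: the inclusion of `not_mem_boxPerc_of_mem_NoArm` holds off the
null set of configurations using non-edges. -/
theorem real_NoArm_le_real_compl_boxPerc (p : unitInterval) (N₀ : ℕ) :
    (bondPercolation (zdGraph 3) p).real (KestenZhang.NoArm (d := 3) N₀) ≤
      (bondPercolation (zdGraph 3) p).real (GM.boxPerc 3 N₀)ᶜ := by
  refine ENNReal.toReal_mono (measure_ne_top _ _) (measure_mono_ae ?_)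
  filter_upwards [ae_subset_edgeSet (zdGraph 3) p] with ω hω hNo
  exact not_mem_boxPerc_of_mem_NoArm hω hNo

/-- **Clause (a) from density alone** (registered stub `stub_noArmSmallOfTheta`): if `θ(p) > 0` on
`ℤ³` then `P_p(NoArm N₀) → 0` as `N₀ → ∞`, in the `ε`–`N₁` form consumed by the Kesten–Zhang
Peierls engine. Grimmett 1999, proof of Thm (8.65), p. 223, at the same density `p`. -/
theorem stub_noArmSmallOfTheta :
    ∀ p : unitInterval, 0 < theta (zdGraph 3) (0 : Site 3) p →
      ∀ ε : ℝ, 0 < ε → ∃ N₁ : ℕ, ∀ N₀ : ℕ, N₁ ≤ N₀ →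
        (bondPercolation (zdGraph 3) p).real (KestenZhang.NoArm (d := 3) N₀) ≤ ε := by
  intro p hθ ε hε
  have ht := GM.tendsto_prob_not_boxPerc (d := 3) p hθ
  obtain ⟨N₁, hN₁⟩ := eventually_atTop.1 (ht.eventually (ge_mem_nhds hε))
  exact ⟨N₁, fun N₀ hN₀ => (real_NoArm_le_real_compl_boxPerc p N₀).trans (hN₁ N₀ hN₀)⟩

end Summit.CriticalPhenomena.PercolationContinuityZ3.Theorems.FiniteClusterVolumeTail

end
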